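import Literature.Probability.Percolation.TwoAvoidanceSets
import Literature.Probability.Percolation.TwoClusterConditionalAssociationProofs
import HarnessLib

/-!
# `NoHeavyLowerTail` (stmt-CriticalPhenomena-4575) — in-cluster / off-cluster exchange

Support file (prover `prim-lf-1`, lemma factory #1; `--supports stmt-CriticalPhenomena-4575`).  No definitions,
no named facts, no sorries.

THE PRINCIPLE behind the random-core rows `CoreAttraction.coreAttraction` (T1′) and
`CoreAttractionSep.coreAttraction_sep` (T2) of this seat, packaged for reuse (seat memo CANDIDATES.md BATCH 8):
let `b` be a vertex, `X` a set of vertices with `b ∉ X`, `D = {b ↮ X}`; let `A₁ = {P₁(C_b)}`, `A₂ = {P₂(C_b)}` be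
events INCREASING in the open edge cluster `C_b`, and let `Q` be increasing in the open edge cluster `C_c` of
another vertex `c`.  Then
  `μ(D ∩ {b↮c} ∩ A₁ ∩ {Q(C_c)}) · μ(D ∩ A₁ᶜ ∩ A₂) ≤ μ(D ∩ A₁ ∩ A₂) · μ(D ∩ {b↮c} ∩ A₁ᶜ ∩ {Q(C_c)})`
(`inCluster_offCluster_exchange`): relative to the pivot `A₁`, an increasing event INSIDE `C_b` (`A₂`) and an
increasing event of a cluster SEPARATED from `b` (`Q(C_c)` on `{b ↮ c}`) pull in opposite directions.  This is
not a two-cluster exchange row of van den Berg–Häggström–Kahn (there all four factors carry `{b ↮ c}`, which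
makes the row vacuous when `A₂` forces `c ∈ C_b`, e.g. `A₂ = {R ⊆ C_b}` with `c ∈ R`).  Proof: given `C_b = W`
the weight `ρ(W) = 1{c ∉ V(W)} · P(Q(C_c) in the fresh variables off W̄)` is DECREASING in `W`; BHK's Thm. 1.3
(conditional positive association of `C_b` given `D`, tree fact `BHK2006_clusterConditionalPositiveAssociation_holds`)
gives `E_D[f h] E_D[1] ≥ E_D[f] E_D[h]` and `E_D[f ρ] E_D[1] ≤ E_D[f] E_D[ρ]` for `f = 1_{A₁}`, `h = 1_{A₂}`,
whence `E_D[fh] E_D[ρ] ≥ E_D[fρ] E_D[h]`, which rearranges to the claim; `E_D[f ρ] = μ(D ∩ {b↮c} ∩ A₁ ∩ Q)` is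
the domain Markov property (`BHK2006.sum_cond_cluster`).
-/

noncomputable section

namespace Summit.CriticalPhenomena.PercolationContinuityZ3.Theorems

open MeasureTheory Set Literature.Probability.LatticeModels Literature.Probability.Percolation
open BHK2006 DecisionTree TwoAvoidanceSets
open scoped Classical BigOperators

namespace OffClusterExchange

variable {V : Type*} [Fintype V]

omit [Fintype V] in
/-- The real indicator of a predicate on edge sets is nonnegative. [folklore] -/
theorem predInd_nonneg (P : Set (Sym2 V) → Prop) (W : Set (Sym2 V)) :
    0 ≤ (if P W then (1 : ℝ) else 0) := by split_ifs <;> norm_num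

omit [Fintype V] in
/-- `∫_D h dμ` as a finite weighted sum. [folklore] -/
theorem setIntegral_eq_sum [Fintype V] (w : Sym2 V → unitInterval) (D : Set (Set (Sym2 V)))
    (h : Set (Sym2 V) → ℝ) :
    ∫ ω in D, h ω ∂(prodBernoulli w) = ∑ ω, weight (fun e => (w e : ℝ)) ω * (h ω * ind D ω) := by
  rw [← integral_indicator MeasurableSet.of_discrete, integral_prodBernoulli_eq_sum]
  refine Finset.sum_congr rfl fun ω _ => ?_
  by_cases hω : ω ∈ D
  · rw [Set.indicator_of_mem hω, ind_of_mem hω, mul_one]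
  · simp [Set.indicator_of_notMem hω, ind_of_not_mem hω]

/-- **In-cluster / off-cluster exchange** (see the module docstring).  `P₁, P₂` monotone predicates of the
open edge cluster of `b`, `Q` a monotone predicate of the open edge cluster of `c`, `b ∉ X`,
`D = {b ↮ x ∀ x ∈ X}`:
`μ(D ∩ {b↮c} ∩ {P₁(C_b)} ∩ {Q(C_c)}) · μ(D ∩ {¬P₁(C_b)} ∩ {P₂(C_b)})`
`  ≤ μ(D ∩ {P₁(C_b)} ∩ {P₂(C_b)}) · μ(D ∩ {b↮c} ∩ {¬P₁(C_b)} ∩ {Q(C_c)})`. [this file] -/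
theorem inCluster_offCluster_exchange (w : Sym2 V → unitInterval) (b c : V) (X : Set V) (hbX : b ∉ X)
    (P₁ P₂ Q : Set (Sym2 V) → Prop) (hP₁ : ∀ ⦃W W'⦄, W ⊆ W' → P₁ W → P₁ W')
    (hP₂ : ∀ ⦃W W'⦄, W ⊆ W' → P₂ W → P₂ W') (hQ : ∀ ⦃W W'⦄, W ⊆ W' → Q W → Q W') :
    (prodBernoulli w).real ({ω : BondConfig V | ∀ x ∈ X, ¬ (openGraph ω).Reachable b x} ∩
        ((openConn b c : Set (BondConfig V))ᶜ ∩ {ω | P₁ (openEdgeCluster ω b)} ∩ {ω | Q (openEdgeCluster ω c)})) *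
      (prodBernoulli w).real ({ω : BondConfig V | ∀ x ∈ X, ¬ (openGraph ω).Reachable b x} ∩
        ({ω | ¬ P₁ (openEdgeCluster ω b)} ∩ {ω | P₂ (openEdgeCluster ω b)})) ≤
    (prodBernoulli w).real ({ω : BondConfig V | ∀ x ∈ X, ¬ (openGraph ω).Reachable b x} ∩
        ({ω | P₁ (openEdgeCluster ω b)} ∩ {ω | P₂ (openEdgeCluster ω b)})) *
      (prodBernoulli w).real ({ω : BondConfig V | ∀ x ∈ X, ¬ (openGraph ω).Reachable b x} ∩
        ((openConn b c : Set (BondConfig V))ᶜ ∩ {ω | ¬ P₁ (openEdgeCluster ω b)} ∩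
          {ω | Q (openEdgeCluster ω c)})) := by
  classical
  set w' : Sym2 V → ℝ := fun e => (w e : ℝ) with hw'
  have hw0 : ∀ e, 0 ≤ w' e := fun e => (w e).2.1
  have hw1 : ∀ e, w' e ≤ 1 := fun e => (w e).2.2
  have hm : ∑ ω, weight w' ω = 1 := by
    have h1 := integral_prodBernoulli_eq_sum w fun _ => (1 : ℝ)
    simp only [integral_const, probReal_univ, smul_eq_mul, mul_one] at h1
    exact h1.symm
  set Da : Set (BondConfig V) := {ω : BondConfig V | ∀ x ∈ X, ¬ (openGraph ω).Reachable b x} with hDa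
  set D : Set (BondConfig V) := (openConn b c : Set (BondConfig V))ᶜ with hDdef
  have hD : ∀ ω, ω ∈ D ↔ ¬ (openGraph ω).Reachable b c := fun ω => Iff.rfl
  set A₁ : Set (BondConfig V) := {ω | P₁ (openEdgeCluster ω b)} with hA₁
  set A₂ : Set (BondConfig V) := {ω | P₂ (openEdgeCluster ω b)} with hA₂
  set QE : Set (BondConfig V) := {ω | Q (openEdgeCluster ω c)} with hQE
  -- real-valued versions of the predicates
  let f : Set (Sym2 V) → ℝ := fun W => if P₁ W then 1 else 0
  let h : Set (Sym2 V) → ℝ := fun W => if P₂ W then 1 else 0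
  let G : Set (Sym2 V) → ℝ := fun E => if Q E then 1 else 0
  let gc : Set (Sym2 V) → ℝ := fun W => if c = b ∨ ∃ e ∈ W, c ∈ e then 0 else 1
  let Abar : Set (Sym2 V) → Set (Sym2 V) := fun W => {e | ∃ v ∈ e, v = b ∨ ∃ e' ∈ W, v ∈ e'}
  let ρW : Set (Sym2 V) → ℝ := fun W => (∑ η, weight w' η * G (openEdgeCluster (η \ Abar W) c)) * gc W
  have hf : ∀ ω : Set (Sym2 V), f (openEdgeCluster ω b) = ind A₁ ω := by
    intro ω; by_cases hω : ω ∈ A₁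
    · simp only [f, if_pos (show P₁ _ from hω), ind_of_mem hω]
    · simp only [f, if_neg (show ¬ P₁ _ from hω), ind_of_not_mem hω]
  have hh : ∀ ω : Set (Sym2 V), h (openEdgeCluster ω b) = ind A₂ ω := by
    intro ω; by_cases hω : ω ∈ A₂
    · simp only [h, if_pos (show P₂ _ from hω), ind_of_mem hω]
    · simp only [h, if_neg (show ¬ P₂ _ from hω), ind_of_not_mem hω]
  have hG : ∀ ω : Set (Sym2 V), G (openEdgeCluster ω c) = ind QE ω := by
    intro ω; by_cases hω : ω ∈ QE
    · simp only [G, if_pos (show Q _ from hω), ind_of_mem hω]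
    · simp only [G, if_neg (show ¬ Q _ from hω), ind_of_not_mem hω]
  have hgc : ∀ ω : Set (Sym2 V), gc (openEdgeCluster ω b) = ind D ω := by
    intro ω
    have : (c = b ∨ ∃ e ∈ openEdgeCluster ω b, c ∈ e) ↔ (openGraph ω).Reachable b c := by
      rw [← reachable_iff_exists_mem_openEdgeCluster]
    by_cases hr : (openGraph ω).Reachable b c
    · have : ω ∉ D := fun h' => (hD ω).1 h' hr
      simp only [gc, if_pos ((reachable_iff_exists_mem_openEdgeCluster ω b c).1 hr), ind_of_not_mem this]
    · simp only [gc, if_neg (fun h' => hr (this.1 h')), ind_of_mem ((hD ω).2 hr)]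
  have hf0 : ∀ W, 0 ≤ f W := fun W => predInd_nonneg P₁ W
  have hf1 : ∀ W, f W ≤ 1 := fun W => by simp only [f]; split_ifs <;> norm_num
  have hh0 : ∀ W, 0 ≤ h W := fun W => predInd_nonneg P₂ W
  have hh1 : ∀ W, h W ≤ 1 := fun W => by simp only [h]; split_ifs <;> norm_num
  have hG0 : ∀ E, 0 ≤ G E := fun E => predInd_nonneg Q E
  have hG1 : ∀ E, G E ≤ 1 := fun E => by simp only [G]; split_ifs <;> norm_num
  have mono_of : ∀ (P : Set (Sym2 V) → Prop), (∀ ⦃W W'⦄, W ⊆ W' → P W → P W') →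
      Monotone fun W => (if P W then (1 : ℝ) else 0) := by
    intro P hP W W' hWW'
    simp only
    by_cases hW : P W
    · rw [if_pos hW, if_pos (hP hWW' hW)]
    · rw [if_neg hW]; split_ifs <;> norm_num
  have hfmono : Monotone f := mono_of P₁ hP₁
  have hhmono : Monotone h := mono_of P₂ hP₂
  have hGmono : Monotone G := mono_of Q hQ
  have hgc_anti : Antitone gc := by
    intro W W' hle
    simp only [gc]
    by_cases hW : c = b ∨ ∃ e ∈ W, c ∈ e
    · rw [if_pos hW, if_pos (hW.imp id fun ⟨e, he, hce⟩ => ⟨e, hle he, hce⟩)]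
    · rw [if_neg hW]; split_ifs <;> norm_num
  have hgc0 : ∀ W, 0 ≤ gc W := fun W => by simp only [gc]; split_ifs <;> norm_num
  have hgc1 : ∀ W, gc W ≤ 1 := fun W => by simp only [gc]; split_ifs <;> norm_num
  have hsum0 : ∀ W, 0 ≤ ∑ η, weight w' η * G (openEdgeCluster (η \ Abar W) c) := fun W =>
    Finset.sum_nonneg fun η _ => mul_nonneg (weight_nonneg hw0 hw1 η) (hG0 _)
  have hsum1 : ∀ W, ∑ η, weight w' η * G (openEdgeCluster (η \ Abar W) c) ≤ 1 := fun W =>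
    calc ∑ η, weight w' η * G (openEdgeCluster (η \ Abar W) c)
        ≤ ∑ η, weight w' η * 1 := Finset.sum_le_sum fun η _ =>
          mul_le_mul_of_nonneg_left (hG1 _) (weight_nonneg hw0 hw1 η)
      _ = 1 := by simp [hm]
  have hρW0 : ∀ W, 0 ≤ ρW W := fun W => mul_nonneg (hsum0 W) (hgc0 W)
  have hρW1 : ∀ W, ρW W ≤ 1 := fun W =>
    (mul_le_mul (hsum1 W) (hgc1 W) (hgc0 _) zero_le_one).trans (by norm_num)
  have hρW_anti : Antitone ρW := by
    intro W W' hle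
    have h1 : ∑ η, weight w' η * G (openEdgeCluster (η \ Abar W') c) ≤
        ∑ η, weight w' η * G (openEdgeCluster (η \ Abar W) c) := by
      refine Finset.sum_le_sum fun η _ => mul_le_mul_of_nonneg_left ?_ (weight_nonneg hw0 hw1 η)
      refine hGmono (openEdgeCluster_mono (fun e he => ?_) c)
      refine ⟨he.1, fun hA => he.2 ?_⟩
      obtain ⟨v, hv, hvb⟩ := hA
      exact ⟨v, hv, hvb.imp id fun ⟨e', he', hve'⟩ => ⟨e', hle he', hve'⟩⟩
    exact mul_le_mul h1 (hgc_anti hle) (hgc0 _) (hsum0 _)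
  -- BHK Thm. 1.3 for `C_b` given `D_X`, as finite sums
  have cpa := BHK2006_clusterConditionalPositiveAssociation_holds V w b X f h hfmono hhmono hbX
  have cpa' := BHK2006_clusterConditionalPositiveAssociation.antitone_right
    BHK2006_clusterConditionalPositiveAssociation_holds V w b X f ρW hfmono hρW_anti hbX
  rw [← hDa] at cpa cpa'
  simp only [setIntegral_eq_sum] at cpa cpa'
  rw [real_eq_sum_ind] at cpa cpa'
  -- domain Markov property of `C_b` towards `C_c`
  have markov : ∀ (φ : Set (Sym2 V) → ℝ),
      ∑ ω, weight w' ω * (φ (openEdgeCluster ω b) * G (openEdgeCluster ω c) * ind D ω) =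
        ∑ ω, weight w' ω * (φ (openEdgeCluster ω b) * ρW (openEdgeCluster ω b)) := by
    intro φ
    have key := sum_cond_cluster w' hm b c (fun W E => φ W * G E) hD
    rw [key]
    refine Finset.sum_congr rfl fun ω _ => ?_
    congr 1
    have e : ∑ η, weight w' η * (φ (openEdgeCluster ω b) *
        G (openEdgeCluster (η \ {e | ∃ v ∈ e, v = b ∨ ∃ e' ∈ openEdgeCluster ω b, v ∈ e'}) c)) =
        φ (openEdgeCluster ω b) * ∑ η, weight w' η *
          G (openEdgeCluster (η \ Abar (openEdgeCluster ω b)) c) := by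
      simp only [Abar, Finset.mul_sum]
      exact Finset.sum_congr rfl fun η _ => by ring
    rw [e, ← hgc ω]
    simp only [ρW]; ring
  -- `ind Da` as a function of `C_b`
  let ga : Set (Sym2 V) → ℝ := fun W => if ∃ x ∈ X, x = b ∨ ∃ e ∈ W, x ∈ e then 0 else 1
  have hga : ∀ ω : Set (Sym2 V), ga (openEdgeCluster ω b) = ind Da ω := by
    intro ω
    by_cases hω : ω ∈ Da
    · have hn : ¬ ∃ x ∈ X, x = b ∨ ∃ e ∈ openEdgeCluster ω b, x ∈ e := by
        rintro ⟨x, hx, hx'⟩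
        exact hω x hx ((reachable_iff_exists_mem_openEdgeCluster ω b x).2 hx')
      simp only [ga, if_neg hn, ind_of_mem hω]
    · have hy : ∃ x ∈ X, x = b ∨ ∃ e ∈ openEdgeCluster ω b, x ∈ e := by
        by_contra hcon
        exact hω fun x hx hr => hcon ⟨x, hx, (reachable_iff_exists_mem_openEdgeCluster ω b x).1 hr⟩
      simp only [ga, if_pos hy, ind_of_not_mem hω]
  -- the four measures as sums
  have e1 : (prodBernoulli w).real (Da ∩ (D ∩ A₁ ∩ QE)) =
      ∑ ω, weight w' ω * (f (openEdgeCluster ω b) * ρW (openEdgeCluster ω b) * ind Da ω) := by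
    rw [real_eq_sum_ind]
    have h2 := markov (fun W => f W * ga W)
    have k1 : ∀ ω, f (openEdgeCluster ω b) * ga (openEdgeCluster ω b) * G (openEdgeCluster ω c) * ind D ω =
        ind (Da ∩ (D ∩ A₁ ∩ QE)) ω := by
      intro ω; rw [hf, hga, hG, ind_inter, ind_inter, ind_inter]; ring
    have k2 : ∀ ω, f (openEdgeCluster ω b) * ga (openEdgeCluster ω b) * ρW (openEdgeCluster ω b) =
        f (openEdgeCluster ω b) * ρW (openEdgeCluster ω b) * ind Da ω := by
      intro ω; rw [hga]; ring
    simp only [k1, k2] at h2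
    exact h2
  have e2 : (prodBernoulli w).real (Da ∩ (D ∩ A₁ᶜ ∩ QE)) =
      ∑ ω, weight w' ω * ((1 - f (openEdgeCluster ω b)) * ρW (openEdgeCluster ω b) * ind Da ω) := by
    rw [real_eq_sum_ind]
    have h2 := markov (fun W => (1 - f W) * ga W)
    have k1 : ∀ ω, (1 - f (openEdgeCluster ω b)) * ga (openEdgeCluster ω b) * G (openEdgeCluster ω c) *
        ind D ω = ind (Da ∩ (D ∩ A₁ᶜ ∩ QE)) ω := by
      intro ω
      have hc : ind (A₁ᶜ) ω = 1 - ind A₁ ω := by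
        by_cases hω : ω ∈ A₁
        · rw [ind_of_mem hω, ind_of_not_mem (show ω ∉ A₁ᶜ from fun h' => h' hω)]; norm_num
        · rw [ind_of_not_mem hω, ind_of_mem (show ω ∈ A₁ᶜ from hω)]; norm_num
      rw [hf, hga, hG, ind_inter, ind_inter, ind_inter, hc]; ring
    have k2 : ∀ ω, (1 - f (openEdgeCluster ω b)) * ga (openEdgeCluster ω b) * ρW (openEdgeCluster ω b) =
        (1 - f (openEdgeCluster ω b)) * ρW (openEdgeCluster ω b) * ind Da ω := by
      intro ω; rw [hga]; ring
    simp only [k1, k2] at h2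
    exact h2
  have e3 : (prodBernoulli w).real (Da ∩ (A₁ ∩ A₂)) =
      ∑ ω, weight w' ω * (f (openEdgeCluster ω b) * h (openEdgeCluster ω b) * ind Da ω) := by
    rw [real_eq_sum_ind]
    refine Finset.sum_congr rfl fun ω _ => ?_
    rw [hf, hh, show Da ∩ (A₁ ∩ A₂) = (A₁ ∩ A₂) ∩ Da from Set.inter_comm _ _, ind_inter, ind_inter]
  have e4 : (prodBernoulli w).real (Da ∩ (A₁ᶜ ∩ A₂)) =
      ∑ ω, weight w' ω * ((1 - f (openEdgeCluster ω b)) * h (openEdgeCluster ω b) * ind Da ω) := by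
    rw [real_eq_sum_ind]
    refine Finset.sum_congr rfl fun ω _ => ?_
    have hc : ind (A₁ᶜ) ω = 1 - ind A₁ ω := by
      by_cases hω : ω ∈ A₁
      · rw [ind_of_mem hω, ind_of_not_mem (show ω ∉ A₁ᶜ from fun h' => h' hω)]; norm_num
      · rw [ind_of_not_mem hω, ind_of_mem (show ω ∈ A₁ᶜ from hω)]; norm_num
    rw [hf, hh, show Da ∩ (A₁ᶜ ∩ A₂) = (A₁ᶜ ∩ A₂) ∩ Da from Set.inter_comm _ _, ind_inter, ind_inter, hc]
  have eC : {ω : BondConfig V | ¬ P₁ (openEdgeCluster ω b)} = A₁ᶜ := rfl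
  rw [eC, e1, e2, e3, e4]
  -- sums
  set Sα := ∑ ω, weight w' ω * ind Da ω with hSα
  set SF := ∑ ω, weight w' ω * (f (openEdgeCluster ω b) * ind Da ω) with hSF
  set SH := ∑ ω, weight w' ω * (h (openEdgeCluster ω b) * ind Da ω) with hSH
  set Sρ := ∑ ω, weight w' ω * (ρW (openEdgeCluster ω b) * ind Da ω) with hSρ
  set SFH := ∑ ω, weight w' ω * (f (openEdgeCluster ω b) * h (openEdgeCluster ω b) * ind Da ω) with hSFH
  set SFρ := ∑ ω, weight w' ω * (f (openEdgeCluster ω b) * ρW (openEdgeCluster ω b) * ind Da ω) with hSFρ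
  have lin1 : ∑ ω, weight w' ω * ((1 - f (openEdgeCluster ω b)) * ρW (openEdgeCluster ω b) * ind Da ω)
      = Sρ - SFρ := by
    rw [hSρ, hSFρ, ← Finset.sum_sub_distrib]; exact Finset.sum_congr rfl fun ω _ => by ring
  have lin2 : ∑ ω, weight w' ω * ((1 - f (openEdgeCluster ω b)) * h (openEdgeCluster ω b) * ind Da ω)
      = SH - SFH := by
    rw [hSH, hSFH, ← Finset.sum_sub_distrib]; exact Finset.sum_congr rfl fun ω _ => by ring
  rw [lin1, lin2]
  have hSα0 : 0 ≤ Sα := Finset.sum_nonneg fun ω _ => mul_nonneg (weight_nonneg hw0 hw1 ω) (ind_nonneg _ _)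
  have hSH0 : 0 ≤ SH := Finset.sum_nonneg fun ω _ =>
    mul_nonneg (weight_nonneg hw0 hw1 ω) (mul_nonneg (hh0 _) (ind_nonneg _ _))
  have hSρ0 : 0 ≤ Sρ := Finset.sum_nonneg fun ω _ =>
    mul_nonneg (weight_nonneg hw0 hw1 ω) (mul_nonneg (hρW0 _) (ind_nonneg _ _))
  have hSFρ0 : 0 ≤ SFρ := Finset.sum_nonneg fun ω _ =>
    mul_nonneg (weight_nonneg hw0 hw1 ω) (mul_nonneg (mul_nonneg (hf0 _) (hρW0 _)) (ind_nonneg _ _))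
  have hSFH0 : 0 ≤ SFH := Finset.sum_nonneg fun ω _ =>
    mul_nonneg (weight_nonneg hw0 hw1 ω) (mul_nonneg (mul_nonneg (hf0 _) (hh0 _)) (ind_nonneg _ _))
  have le1 : ∀ (g : Set (Sym2 V) → ℝ), (∀ W, 0 ≤ g W) → (∀ W, g W ≤ 1) →
      ∑ ω, weight w' ω * (f (openEdgeCluster ω b) * g (openEdgeCluster ω b) * ind Da ω) ≤ Sα := by
    intro g hg0 hg1
    refine Finset.sum_le_sum fun ω _ => mul_le_mul_of_nonneg_left ?_ (weight_nonneg hw0 hw1 ω)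
    calc f (openEdgeCluster ω b) * g (openEdgeCluster ω b) * ind Da ω ≤ 1 * 1 * ind Da ω :=
          mul_le_mul_of_nonneg_right (mul_le_mul (hf1 _) (hg1 _) (hg0 _) zero_le_one) (ind_nonneg _ _)
      _ = ind Da ω := by ring
  have hSFρ_le : SFρ ≤ Sα := le1 ρW hρW0 hρW1
  have hSFH_le : SFH ≤ Sα := le1 h hh0 hh1
  have c1 : SF * SH ≤ Sα * SFH := cpa
  have c2 : Sα * SFρ ≤ SF * Sρ := cpa'
  by_cases hα : Sα = 0
  · have h1 : SFρ = 0 := le_antisymm (hα ▸ hSFρ_le) hSFρ0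
    have h2 : SFH = 0 := le_antisymm (hα ▸ hSFH_le) hSFH0
    rw [h1, h2]; simp
  · have hαpos : 0 < Sα := lt_of_le_of_ne hSα0 (Ne.symm hα)
    have key : Sα * (SH * SFρ) ≤ Sα * (SFH * Sρ) := by nlinarith [c1, c2, hSρ0, hSH0]
    have key' : SH * SFρ ≤ SFH * Sρ := le_of_mul_le_mul_left key hαpos
    nlinarith [key', hSFρ0, hSFH0]

end OffClusterExchange

end Summit.CriticalPhenomena.PercolationContinuityZ3.Theorems

end
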